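import Summits.MatrixMultiplication.MatrixMultiplication.Theses.FarEdgeDescent
import Literature.Computability.AlgebraicComplexity.RectangularExponentInformationBound
import Literature.Computability.AlgebraicComplexity.RectangularExponentSymmetry

/-!
# Route `FarEdgeDescent`, special leaf `FiniteSaturation`: the zero set of the excess at the far corner

Support module (def-free, kernel only) for crux `FiniteSaturation` (stmt-MatrixMultiplication-23739) of
`Summits/MatrixMultiplication/MatrixMultiplication/Theses/FarEdgeDescent.lean`; the cut of record
`ω = 2 ⟺ FiniteSaturation ∧ AnchoredLogConvexity` is unchanged.  Cell `decomp-mm`, lens 2 (structural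
dichotomy special / generic), generation 13.

Normalise a far shape by its long side, `ω(1,k,t) = k·ω(1/k, 1, t/k)` (Lotti–Romani homogeneity), and
on the CORNER SQUARE `(a, c) ∈ [0,1]²` of shapes `(a, 1, c)` consider the excess over the information
bound `E(a,c) := ω(a,1,c) − (1 + max a c) ≥ 0` (`corner_lower`) and its ZERO SET `Z := {E = 0}`:
* `E ≤ (ω − 2)·min a c` (`corner_upper`), so `ω = 2 ⟺ (1,1) ∈ Z ⟺ Z = [0,1]²` (`mm_iff_square`);
* `(1/k, 1/k) ∈ Z ⟺ ω(1,k,1) = k + 1` (`roof_iff_diag`): `FiniteSaturation ⟺ Z ∋ (s,s)` for some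
  `0 < s ≤ 1/2 ⟺ Z ⊇ [0,s]²` for some `s > 0` (`finiteSaturation_iff_diag`, `finiteSaturation_iff_corner`);
* a tight pair `ω(1,t,r) = 1 + r` of the sibling ladder (lens 1) is the point `(1/r, t/r) ∈ Z`.

STRUCTURE OF `Z` (kernel, from Lotti–Romani 1983 §1 and Huang–Pan 1998 §2 in the tree): symmetric
(`sat_symm`); star-shaped from the corner (`sat_star`); on the side `a ≤ c` a LOWER set in the short
exponent (`sat_lower_fst`) and an UPPER set in the long one (`sat_upper_snd`); CONVEX on each side of the
diagonal (`sat_convex`: `ω` is convex, `1 + max a c` is linear there); it contains Coppersmith's WEDGES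
`{a ≤ α c} ∪ {c ≤ α a}` (`sat_wedge`, `α = dualExponentAlpha ℂ`) and lies in the STRIPS `{min a c ≤ α}`
(`sat_strip`).  Consequences: **every roof certifies a dual exponent**, `ω(1,k,1) = k+1 ⟹ 1/k ≤ α`
(`roof_le_alpha`; a roof at `k = 3` would give `α ≥ 1/3 > 0.321334`), and every tight pair of lens 1 has
`t/r ≤ α` (`tight_le_alpha`); the **junction inequality** `ω(1,k,1) − (k+1) ≤ 1 − t` whenever
`ω(1,k,t) = k+1` (`excess_le_deficit`: this route's excess is at most lens 1's dual-exponent deficit at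
the same `k`); the saturated region `{ω(1,k,t) = k+1}` is monotone and convex (`sat_region_mono`,
`sat_region_convex`).  **Ray dichotomy** (`corner_dichotomy_generic/special`): by lens 1's PROVED
`EventualTightness` (stmt-24102; hypothesis `hET` here) and star-shapedness EVERY NON-DIAGONAL RAY from
the corner has an initial segment in `Z`; the DIAGONAL has one iff `FiniteSaturation`.  So on each side
of the diagonal `Z` is a convex region between wedge and strip, tangent to the diagonal at the corner, and
the special leaf asks whether the two regions meet along a diagonal segment or only at the corner
(`round_world`).  The diagonal is special BY CONSTRUCTION — it is the kink locus of the light value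
`1 + max a c`, across which convexity of `ω` propagates nothing: generic directions settled, the special
one is the crux.  Placement: wedge = Coppersmith's `α` (Le Gall 2012 §1) with blocking; off-diagonal
segments = lens 1's theorem; strip, roof-to-`α`, junction inequality and the convex-lens description are,
as far as the cell's census knows, not in print.
[cite: LottiRomani1983, §1 (p. 173)] [cite: HuangPan1998, §2 eq. (2.5)–(2.8)] [cite: LeGall2012, §1]
-/

set_option linter.dupNamespace false

namespace Summit.MatrixMultiplication.MatrixMultiplication.Theorems.FarEdgeDescentCornerZeroSet

open Literature.Computability.AlgebraicComplexity
open Summit.MatrixMultiplication.MatrixMultiplication.Theses.FarEdgeDescent (FiniteSaturation)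

/-! ## The sandwich at the corner -/

/-- Information bound in corner form: `1 + max a c ≤ ω(a, 1, c)`. [cite: HuangPan1998, §2 eq. (2.8) (p. 262)] -/
theorem corner_lower (a c : ℝ) : 1 + max a c ≤ omegaRect ℂ a 1 c := by
  rcases le_total a c with h | h
  · rw [max_eq_right h]; linarith [add_le_omegaRect₂₃ ℂ a 1 c]
  · rw [max_eq_left h]; linarith [add_le_omegaRect₁₂ ℂ a 1 c]

/-- Huang–Pan blocking: `ω(a,1,c) ≤ 1 + max a c + (ω − 2)·min a c`. [cite: HuangPan1998, §2 eq. (2.5)–(2.8) (p. 261–262)] -/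
theorem corner_upper {a c : ℝ} (ha : 0 ≤ a) (hc : 0 ≤ c) (hc1 : c ≤ 1) :
    omegaRect ℂ a 1 c ≤ 1 + max a c + (omega ℂ - 2) * min a c := by
  have h := omegaRect_sub_information_le ℂ ha zero_le_one hc
  rw [min_eq_right hc1] at h
  rcases le_total a c with h' | h'
  · rw [max_eq_right h', min_eq_left h'] at *; linarith
  · rw [max_eq_left h', min_eq_right h'] at *; linarith

/-- The corner itself is saturated: `ω(0,1,0) = 1`. [cite: HuangPan1998, §2 eq. (2.4) (p. 261)] -/
theorem sat_corner : omegaRect ℂ 0 1 0 = 1 + max 0 0 := by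
  rw [max_self, add_zero, omegaRect_eq_add_of_nonpos₃ ℂ le_rfl zero_le_one le_rfl, zero_add]

/-! ## Structure of the zero set `Z = {ω(a,1,c) = 1 + max a c}` -/

/-- `Z` is symmetric in `a ↔ c`. [cite: LottiRomani1983, §1 (p. 173)] -/
theorem sat_symm {a c : ℝ} :
    omegaRect ℂ a 1 c = 1 + max a c ↔ omegaRect ℂ c 1 a = 1 + max c a := by
  rw [omegaRect_swap₁₃ ℂ a 1 c, max_comm]

/-- On the side `a ≤ c`, `Z` is an upper set in the long exponent `c`. [cite: LottiRomani1983, §1 (p. 173)] -/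
theorem sat_upper_snd {a c c' : ℝ} (hac : a ≤ c) (hcc : c ≤ c')
    (h : omegaRect ℂ a 1 c = 1 + max a c) : omegaRect ℂ a 1 c' = 1 + max a c' := by
  have h1 := omegaRect_add_le_add_pos ℂ a 1 c 0 0 (c' - c)
  rw [add_zero, add_zero, add_sub_cancel, max_self, max_eq_left (sub_nonneg.2 hcc)] at h1
  have h2 := corner_lower a c'
  rw [max_eq_right hac] at h
  rw [max_eq_right (hac.trans hcc)] at h2 ⊢
  linarith

/-- `Z` is star-shaped from the corner: `(a,c) ∈ Z ⟹ (μa, μc) ∈ Z`, `0 ≤ μ ≤ 1`. [cite: LottiRomani1983, §1 (p. 173)] -/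
theorem sat_star {a c μ : ℝ} (ha : 0 ≤ a) (hc : 0 ≤ c) (hμ0 : 0 ≤ μ) (hμ1 : μ ≤ 1)
    (h : omegaRect ℂ a 1 c = 1 + max a c) :
    omegaRect ℂ (μ * a) 1 (μ * c) = 1 + max (μ * a) (μ * c) := by
  have h1 := omegaRect_add_le_add_pos ℂ (μ * a) (μ * 1) (μ * c) 0 (1 - μ) 0
  rw [add_zero, add_zero, mul_one, add_sub_cancel, max_self, max_eq_left (sub_nonneg.2 hμ1), zero_add,
    add_zero] at h1
  have h2 : omegaRect ℂ (μ * a) (μ * 1) (μ * c) = μ * omegaRect ℂ a 1 c :=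
    LottiRomani1983_homogeneous ℂ hμ0 ha zero_le_one hc
  rw [mul_one] at h2
  have h3 := corner_lower (μ * a) (μ * c)
  have hmax : max (μ * a) (μ * c) = μ * max a c := (mul_max_of_nonneg a c hμ0).symm
  rw [hmax] at h3 ⊢
  rw [h2, h] at h1
  nlinarith

/-- On the side `a ≤ c`, `Z` is a lower set in the short exponent `a ≥ 0` (star to `(a', a'c/a)`, then
up in the long exponent). [cite: LottiRomani1983, §1 (p. 173)] -/
theorem sat_lower_fst {a a' c : ℝ} (ha' : 0 ≤ a') (haa : a' ≤ a) (hac : a ≤ c)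
    (h : omegaRect ℂ a 1 c = 1 + max a c) : omegaRect ℂ a' 1 c = 1 + max a' c := by
  rcases (ha'.trans haa).eq_or_lt with ha0 | ha0
  · have ha'0 : a' = 0 := le_antisymm (ha0 ▸ haa) ha'
    rw [ha'0, ha0]; exact h
  · have hc0 : 0 ≤ c := ha0.le.trans hac
    have hμ1 : a' / a ≤ 1 := (div_le_one ha0).2 haa
    have hst := sat_star ha0.le hc0 (div_nonneg ha' ha0.le) hμ1 h
    rw [div_mul_cancel₀ a' ha0.ne'] at hst
    have hle : a' / a * c ≤ c := mul_le_of_le_one_left hc0 hμ1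
    have hle' : a' ≤ a' / a * c := by
      have := mul_le_mul_of_nonneg_left hac (div_nonneg ha' ha0.le)
      rwa [div_mul_cancel₀ a' ha0.ne'] at this
    exact sat_upper_snd hle' hle hst

/-- `Z` is CONVEX on the side `a ≤ c` (joint convexity of `ω`, Lotti–Romani; the light value `1 + c` is
linear there); e.g. the whole chord from a point of `Z` to `(α, 1) ∈ Z` (`sat_wedge`) lies in `Z`.
[cite: LottiRomani1983, §1 (p. 173)] -/
theorem sat_convex {a₁ c₁ a₂ c₂ μ : ℝ} (h0₁ : 0 ≤ a₁) (h₁ : a₁ ≤ c₁) (h0₂ : 0 ≤ a₂) (h₂ : a₂ ≤ c₂)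
    (hμ0 : 0 ≤ μ) (hμ1 : μ ≤ 1) (hs₁ : omegaRect ℂ a₁ 1 c₁ = 1 + max a₁ c₁)
    (hs₂ : omegaRect ℂ a₂ 1 c₂ = 1 + max a₂ c₂) :
    omegaRect ℂ (μ * a₁ + (1 - μ) * a₂) 1 (μ * c₁ + (1 - μ) * c₂) =
      1 + max (μ * a₁ + (1 - μ) * a₂) (μ * c₁ + (1 - μ) * c₂) := by
  have h := LottiRomani1983_convexComb_le ℂ (x := a₁) (y := 1) (z := c₁) (x' := a₂) (y' := 1)
    (z' := c₂) (a := μ) (b := 1 - μ) h0₁ zero_le_one (h0₁.trans h₁) h0₂ zero_le_one (h0₂.trans h₂)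
    hμ0 (sub_nonneg.2 hμ1)
  have h1 : μ * 1 + (1 - μ) * 1 = 1 := by ring
  rw [h1] at h
  have hle : μ * a₁ + (1 - μ) * a₂ ≤ μ * c₁ + (1 - μ) * c₂ :=
    add_le_add (mul_le_mul_of_nonneg_left h₁ hμ0) (mul_le_mul_of_nonneg_left h₂ (sub_nonneg.2 hμ1))
  have h3 := corner_lower (μ * a₁ + (1 - μ) * a₂) (μ * c₁ + (1 - μ) * c₂)
  rw [max_eq_right h₁] at hs₁
  rw [max_eq_right h₂] at hs₂
  rw [max_eq_right hle] at h3 ⊢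
  rw [hs₁, hs₂] at h
  linarith

/-- **Coppersmith's wedge**: `a ≤ α·c` (`0 ≤ c ≤ 1`) forces `(a,c) ∈ Z` (`ω(a,1,c) ≤ ω(a,c,c) + (1−c)`,
`ω(a,c,c) = c·ω(1, a/c, 1) = 2c`); un-normalised, `ω(1,t,r) = 1 + r` for `t ≤ α ≤ 1 ≤ r`. [cite: LeGall2012, §1] -/
theorem sat_wedge {a c : ℝ} (ha : 0 ≤ a) (hc0 : 0 ≤ c) (hc1 : c ≤ 1)
    (hac : a ≤ dualExponentAlpha ℂ * c) : omegaRect ℂ a 1 c = 1 + max a c := by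
  have hα1 := dualExponentAlpha_le_one ℂ
  have hac' : a ≤ c := hac.trans (by nlinarith)
  rcases hc0.eq_or_lt with hc | hc
  · subst hc
    have ha0 : a = 0 := le_antisymm (by simpa using hac) ha
    subst ha0
    exact sat_corner
  · refine le_antisymm ?_ (corner_lower a c)
    have hq : a / c ≤ dualExponentAlpha ℂ := by rwa [div_le_iff₀ hc]
    have h2 : omegaRect ℂ 1 (a / c) 1 = 2 := omegaRect_eq_two_of_le_dualExponentAlpha ℂ hq
    have h3 : omegaRect ℂ (c * (a / c)) (c * 1) (c * 1) = c * omegaRect ℂ (a / c) 1 1 :=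
      LottiRomani1983_homogeneous ℂ hc.le (div_nonneg ha hc.le) zero_le_one zero_le_one
    rw [mul_div_cancel₀ a hc.ne', mul_one, omegaRect_swap₁₂ ℂ (a / c) 1 1, h2] at h3
    have h4 := omegaRect_add_le_add_pos ℂ a c c 0 (1 - c) 0
    rw [add_zero, add_zero, add_sub_cancel, max_self, max_eq_left (sub_nonneg.2 hc1), zero_add,
      add_zero, h3] at h4
    rw [max_eq_right hac']
    linarith

/-- **The strip**: a point of `Z` on the side `a ≤ c ≤ 1` has short exponent `a ≤ α` (upper set in `c`:
`(a,1) ∈ Z`, i.e. `ω(1,a,1) = 2`). [cite: LeGall2012, §1] -/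
theorem sat_strip {a c : ℝ} (hac : a ≤ c) (hc1 : c ≤ 1) (h : omegaRect ℂ a 1 c = 1 + max a c) :
    a ≤ dualExponentAlpha ℂ := by
  have h1 := sat_upper_snd hac hc1 h
  rw [max_eq_right (hac.trans hc1)] at h1
  have h2 : omegaRect ℂ 1 a 1 = 2 := by rw [omegaRect_swap₁₂ ℂ 1 a 1, h1]; norm_num
  exact le_dualExponentAlpha_of_omegaRect_eq_two ℂ h2

/-- **Off-diagonal rays (junction with lens 1)**: for every direction `t ∈ [0,1)` some `(a, t·a) ∈ Z`,
`0 < a ≤ 1` — the normalised form (`a = 1/r`) of a tight pair `ω(1,t,r) ≤ 1 + r`.  The hypothesis `hET`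
IS item `EventualTightness` of route `SaturationLadder` (stmt-MatrixMultiplication-24102), CLOSED·proved
by `SaturationLadderExpSaturation.eventualTightness_holds`; it is spelled out so that this module stays
outside that route's build cone. [cite: HuangPan1998, §2 eq. (2.8) (p. 262)] -/
theorem sat_offDiagonal (hET : ∀ t : ℝ, 0 ≤ t → t < 1 → ∃ r : ℝ, 1 ≤ r ∧ omegaRect ℂ 1 t r ≤ 1 + r)
    {t : ℝ} (ht0 : 0 ≤ t) (ht1 : t < 1) :
    ∃ a : ℝ, 0 < a ∧ a ≤ 1 ∧ omegaRect ℂ a 1 (t * a) = 1 + max a (t * a) := by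
  obtain ⟨r, hr1, hr⟩ := hET t ht0 ht1
  have hr0 : 0 < r := by linarith
  refine ⟨1 / r, by positivity, by rw [div_le_one hr0]; exact hr1, ?_⟩
  have hhom : omegaRect ℂ (r * (1 / r)) (r * (t / r)) (r * 1) = r * omegaRect ℂ (1 / r) (t / r) 1 :=
    LottiRomani1983_homogeneous ℂ hr0.le (by positivity) (div_nonneg ht0 hr0.le) zero_le_one
  rw [mul_one_div_cancel hr0.ne', mul_div_cancel₀ t hr0.ne', mul_one] at hhom
  have hta : t * (1 / r) = t / r := by ring
  have hle : t * (1 / r) ≤ 1 / r := mul_le_of_le_one_left (by positivity) ht1.le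
  rw [max_eq_left hle, omegaRect_swap₂₃ ℂ (1 / r) 1 (t * (1 / r)), hta]
  refine le_antisymm ?_ ?_
  · rw [hhom] at hr
    have : omegaRect ℂ (1 / r) (t / r) 1 ≤ (1 + r) / r := by rw [le_div_iff₀ hr0]; linarith
    calc omegaRect ℂ (1 / r) (t / r) 1 ≤ (1 + r) / r := this
      _ = 1 + 1 / r := by field_simp; ring
  · have h := corner_lower (1 / r) (t / r)
    rw [← hta, max_eq_left hle, omegaRect_swap₂₃ ℂ (1 / r) 1, hta] at h
    exact h

/-! ## The diagonal -/

/-- Normalising the far edge: `ω(1,k,1) − (k+1) = k·E(1/k, 1/k)` (`k > 0`). [cite: LottiRomani1983, §1 (p. 173)] -/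
theorem excess_diag {k : ℝ} (hk : 0 < k) :
    omegaRect ℂ 1 k 1 - (k + 1) = k * (omegaRect ℂ (1 / k) 1 (1 / k) - (1 + 1 / k)) := by
  have hhom : omegaRect ℂ (k * (1 / k)) (k * 1) (k * (1 / k)) = k * omegaRect ℂ (1 / k) 1 (1 / k) :=
    LottiRomani1983_homogeneous ℂ hk.le (by positivity) zero_le_one (by positivity)
  rw [mul_one_div_cancel hk.ne', mul_one] at hhom
  rw [hhom, mul_sub, mul_add, mul_one_div_cancel hk.ne', mul_one]

/-- **A roof is a diagonal point of `Z`**: `ω(1,k,1) = k+1 ⟺ (1/k, 1/k) ∈ Z`. [cite: LottiRomani1983, §1 (p. 173)] -/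
theorem roof_iff_diag {k : ℝ} (hk : 0 < k) :
    omegaRect ℂ 1 k 1 = k + 1 ↔ omegaRect ℂ (1 / k) 1 (1 / k) = 1 + max (1 / k) (1 / k) := by
  rw [max_self, ← sub_eq_zero, excess_diag hk, mul_eq_zero, sub_eq_zero, or_iff_right hk.ne']

/-- **Every roof certifies a dual exponent: `ω(1,k,1) = k + 1 ⟹ 1/k ≤ α`** (`k ≥ 1`; the diagonal point
`(1/k,1/k)` lies in the strip), so `FiniteSaturation`'s witness has `k ≥ 1/α`; e.g. a roof at `k = 3`
would give `α ≥ 1/3 > 0.321334`.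
[cite: LeGall2012, §1] -/
theorem roof_le_alpha {k : ℝ} (hk : 1 ≤ k) (h : omegaRect ℂ 1 k 1 = k + 1) :
    1 / k ≤ dualExponentAlpha ℂ := by
  have hk0 : 0 < k := by linarith
  exact sat_strip le_rfl (by rw [div_le_one hk0]; exact hk) ((roof_iff_diag hk0).1 h)

/-- **Every tight pair of lens 1 certifies a dual exponent: `ω(1,t,r) ≤ 1 + r ⟹ t/r ≤ α`**
(`0 ≤ t ≤ 1 ≤ r`; `(t/r, 1/r)` lies in the strip): the saturation ladder has `r(t) ≥ t/α`. [cite: LeGall2012, §1] -/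
theorem tight_le_alpha {t r : ℝ} (ht0 : 0 ≤ t) (ht1 : t ≤ 1) (hr : 1 ≤ r)
    (h : omegaRect ℂ 1 t r ≤ 1 + r) : t / r ≤ dualExponentAlpha ℂ := by
  have hr0 : 0 < r := by linarith
  have hhom : omegaRect ℂ (r * (1 / r)) (r * (t / r)) (r * 1) = r * omegaRect ℂ (1 / r) (t / r) 1 :=
    LottiRomani1983_homogeneous ℂ hr0.le (by positivity) (div_nonneg ht0 hr0.le) zero_le_one
  rw [mul_one_div_cancel hr0.ne', mul_div_cancel₀ t hr0.ne', mul_one] at hhom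
  have hle : t / r ≤ 1 / r := div_le_div_of_nonneg_right ht1 hr0.le
  refine sat_strip hle (by rw [div_le_one hr0]; exact hr) (le_antisymm ?_ (corner_lower _ _))
  rw [max_eq_right hle, omegaRect_swap₁₃ ℂ (t / r) 1 (1 / r), omegaRect_swap₂₃ ℂ (1 / r) 1 (t / r)]
  rw [hhom] at h
  have : omegaRect ℂ (1 / r) (t / r) 1 ≤ (1 + r) / r := by rw [le_div_iff₀ hr0]; linarith
  calc omegaRect ℂ (1 / r) (t / r) 1 ≤ (1 + r) / r := this
    _ = 1 + 1 / r := by field_simp; ring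

/-- **`FiniteSaturation ⟺ Z` meets the diagonal in `(0, 1/2]`.** (`→`: `s = 1/k`; `←`: star-shapedness
moves `(s,s)` to `(1/k,1/k)` with `k = ⌈1/s⌉ ≥ 2`.) [cite: LottiRomani1983, §1 (p. 173)] -/
theorem finiteSaturation_iff_diag :
    FiniteSaturation ↔ ∃ s : ℝ, 0 < s ∧ s ≤ 1 / 2 ∧ omegaRect ℂ s 1 s = 1 + max s s := by
  constructor
  · rintro ⟨k, hk2, hk⟩
    have hk2' : (2 : ℝ) ≤ k := by exact_mod_cast hk2
    have hk0 : (0 : ℝ) < k := by linarith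
    refine ⟨1 / k, by positivity, div_le_div_of_nonneg_left zero_le_one two_pos hk2', ?_⟩
    exact (roof_iff_diag hk0).1 hk
  · rintro ⟨s, hs0, hs2, hs⟩
    have h1s : (2 : ℝ) ≤ 1 / s := by rw [le_div_iff₀ hs0]; linarith
    obtain ⟨k, hk⟩ : ∃ k : ℕ, (k : ℝ) = ⌈1 / s⌉₊ := ⟨_, rfl⟩
    have hks : 1 / s ≤ k := hk ▸ Nat.le_ceil _
    have hk2 : (2 : ℝ) ≤ k := h1s.trans hks
    have hk0 : (0 : ℝ) < k := by linarith
    have hμ1 : 1 / (k * s) ≤ 1 := by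
      rw [div_le_one (by positivity)]
      have := mul_le_mul_of_nonneg_right hks hs0.le
      rwa [one_div_mul_cancel hs0.ne'] at this
    have hstar := sat_star hs0.le hs0.le (by positivity) hμ1 hs
    have he : 1 / (k * s) * s = 1 / k := by field_simp
    rw [he] at hstar
    refine ⟨k, by exact_mod_cast hk2, (roof_iff_diag hk0).2 hstar⟩

/-- **`FiniteSaturation ⟺ Z ⊇ [0,s]²` for some `s > 0`** (lower set + symmetry + star): for small far
shapes the excess vanishes IDENTICALLY, `ω(a,1,c) = 1 + max a c`. [cite: LottiRomani1983, §1 (p. 173)] -/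
theorem finiteSaturation_iff_corner :
    FiniteSaturation ↔ ∃ s : ℝ, 0 < s ∧ ∀ a c : ℝ, 0 ≤ a → a ≤ s → 0 ≤ c → c ≤ s →
      omegaRect ℂ a 1 c = 1 + max a c := by
  constructor
  · intro h
    obtain ⟨s, hs0, -, hs⟩ := finiteSaturation_iff_diag.1 h
    refine ⟨s, hs0, fun a c ha has hc hcs => ?_⟩
    have hdiag : ∀ m : ℝ, 0 ≤ m → m ≤ s → omegaRect ℂ m 1 m = 1 + max m m := by
      intro m hm0 hms
      have hst := sat_star hs0.le hs0.le (div_nonneg hm0 hs0.le) ((div_le_one hs0).2 hms) hs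
      rwa [div_mul_cancel₀ m hs0.ne'] at hst
    rcases le_total a c with hac | hca
    · exact sat_lower_fst ha hac le_rfl (hdiag c hc hcs)
    · exact sat_symm.1 (sat_lower_fst hc hca le_rfl (hdiag a ha has))
  · rintro ⟨s, hs0, h⟩
    refine finiteSaturation_iff_diag.2 ⟨min s (1 / 2), lt_min hs0 (by norm_num), min_le_right _ _, ?_⟩
    exact h _ _ (le_min hs0.le (by norm_num)) (min_le_left _ _) (le_min hs0.le (by norm_num))
      (min_le_left _ _)

/-- The summit is the opposite corner: `ω = 2 ⟺ (1,1) ∈ Z ⟺ Z = [0,1]²` (Huang–Pan's characterisation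
in corner form). [cite: HuangPan1998, §2 eq. (2.5)–(2.8) (p. 261–262)] -/
theorem mm_iff_square : _root_.MatrixMultiplication ↔
    ∀ a c : ℝ, 0 ≤ a → a ≤ 1 → 0 ≤ c → c ≤ 1 → omegaRect ℂ a 1 c = 1 + max a c := by
  constructor
  · intro h a c ha _ hc hc1
    have hω := _root_.MatrixMultiplication_iff.1 h
    have hup := corner_upper ha hc hc1
    rw [hω, sub_self, zero_mul, add_zero] at hup
    exact le_antisymm hup (corner_lower a c)
  · intro h
    have h1 := h 1 1 zero_le_one le_rfl zero_le_one le_rfl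
    rw [max_self, omegaRect_one_one_one] at h1
    exact _root_.MatrixMultiplication_iff.2 (by linarith)

/-! ## The junction with the saturation ladder and the ray dichotomy -/

/-- **Junction inequality**: saturation of `(1,k,t)` bounds the far-edge excess at the same `k`,
`ω(1,k,1) − (k+1) ≤ 1 − t` — the excess of this route is at most the dual-exponent DEFICIT `1 − t` of any
saturated `t` (lens 1's ladder read at amortisation `k`). [cite: LottiRomani1983, §1 (p. 173)] -/
theorem excess_le_deficit {k t : ℝ} (ht1 : t ≤ 1) (h : omegaRect ℂ 1 k t = k + 1) :
    omegaRect ℂ 1 k 1 - (k + 1) ≤ 1 - t := by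
  have h1 := omegaRect_add_le_add_pos ℂ 1 k t 0 0 (1 - t)
  rw [add_zero, add_zero, add_sub_cancel, max_self, max_eq_left (sub_nonneg.2 ht1), zero_add] at h1
  linarith

/-- The saturated region `{(k,t) : ω(1,k,t) = k+1}` is monotone: up in `k` (subadditivity), down in `t`
(homogeneity: scale by `t'/t`, then pad the first two slots). [cite: LottiRomani1983, §1 (p. 173)] -/
theorem sat_region_mono {k k' t t' : ℝ} (hk : 0 ≤ k) (ht' : 0 ≤ t') (hkk : k ≤ k') (htt : t' ≤ t)
    (h : omegaRect ℂ 1 k t = k + 1) : omegaRect ℂ 1 k' t' = k' + 1 := by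
  refine le_antisymm ?_ (by linarith [add_le_omegaRect₁₂ ℂ 1 k' t'])
  have h1 : omegaRect ℂ 1 k t' ≤ k + 1 := by
    rcases (ht'.trans htt).eq_or_lt with ht0 | ht0
    · have ht'0 : t' = 0 := le_antisymm (ht0 ▸ htt) ht'
      rw [ht'0, omegaRect_eq_add_of_nonpos₃ ℂ zero_le_one hk le_rfl]; linarith
    · have hμ0 : 0 ≤ t' / t := div_nonneg ht' ht0.le
      have hμ1 : t' / t ≤ 1 := (div_le_one ht0).2 htt
      have hhom : omegaRect ℂ (t' / t * 1) (t' / t * k) (t' / t * t) = t' / t * omegaRect ℂ 1 k t :=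
        LottiRomani1983_homogeneous ℂ hμ0 zero_le_one hk ht0.le
      rw [div_mul_cancel₀ t' ht0.ne', h] at hhom
      have h2 := omegaRect_add_le_add_pos ℂ (t' / t * 1) (t' / t * k) t' (1 - t' / t)
        ((1 - t' / t) * k) 0
      rw [add_zero, hhom, max_eq_left (sub_nonneg.2 hμ1), max_eq_left (mul_nonneg (sub_nonneg.2 hμ1) hk),
        max_self, add_zero] at h2
      have e1 : t' / t * 1 + (1 - t' / t) = 1 := by ring
      have e2 : t' / t * k + (1 - t' / t) * k = k := by ring
      have e3 : t' / t * (k + 1) = t' / t * k + t' / t := by ring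
      have e4 : (1 - t' / t) * k = k - t' / t * k := by ring
      rw [e1, e2] at h2
      linarith
  have h2 := omegaRect_add_le_add_pos ℂ 1 k t' 0 (k' - k) 0
  rw [add_zero, add_zero, add_sub_cancel, max_self, max_eq_left (sub_nonneg.2 hkk), zero_add,
    add_zero] at h2
  linarith

/-- **The ray dichotomy at the far corner, generic half**: every non-diagonal ray `c = t·a` or
`a = t·c` (`0 ≤ t < 1`) has an initial segment inside `Z` — lens 1's `EventualTightness` (`hET`, proved in
the tree) plus star-shapedness.  Settled. [cite: HuangPan1998, §2 eq. (2.8) (p. 262)] -/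
theorem corner_dichotomy_generic
    (hET : ∀ t : ℝ, 0 ≤ t → t < 1 → ∃ r : ℝ, 1 ≤ r ∧ omegaRect ℂ 1 t r ≤ 1 + r)
    {t : ℝ} (ht0 : 0 ≤ t) (ht1 : t < 1) :
    ∃ a : ℝ, 0 < a ∧ ∀ μ : ℝ, 0 ≤ μ → μ ≤ a →
      omegaRect ℂ μ 1 (t * μ) = 1 + max μ (t * μ) ∧ omegaRect ℂ (t * μ) 1 μ = 1 + max (t * μ) μ := by
  obtain ⟨a, ha0, -, ha⟩ := sat_offDiagonal hET ht0 ht1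
  refine ⟨a, ha0, fun μ hμ0 hμa => ?_⟩
  have hst := sat_star ha0.le (mul_nonneg ht0 ha0.le) (div_nonneg hμ0 ha0.le) ((div_le_one ha0).2 hμa)
    ha
  rw [div_mul_cancel₀ μ ha0.ne', ← mul_assoc, mul_comm (μ / a) t, mul_assoc,
    div_mul_cancel₀ μ ha0.ne'] at hst
  exact ⟨hst, sat_symm.1 hst⟩

/-- **The ray dichotomy at the far corner, special half**: the DIAGONAL has an initial segment inside `Z`
iff `FiniteSaturation` — the special leaf is exactly the kink direction of the light value.
[cite: LottiRomani1983, §1 (p. 173)] -/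
theorem corner_dichotomy_special :
    (∃ a : ℝ, 0 < a ∧ a ≤ 1 / 2 ∧ ∀ μ : ℝ, 0 ≤ μ → μ ≤ a → omegaRect ℂ μ 1 μ = 1 + max μ μ) ↔
      FiniteSaturation := by
  refine ⟨fun ⟨a, ha0, ha2, h⟩ => ?_, fun h => ?_⟩
  · exact finiteSaturation_iff_diag.2 ⟨a, ha0, ha2, h a ha0.le le_rfl⟩
  · obtain ⟨s, hs0, hs2, hs⟩ := finiteSaturation_iff_diag.1 h
    refine ⟨s, hs0, hs2, fun μ hμ0 hμs => ?_⟩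
    have hst := sat_star hs0.le hs0.le (div_nonneg hμ0 hs0.le) ((div_le_one hs0).2 hμs) hs
    rwa [div_mul_cancel₀ μ hs0.ne'] at hst

/-- **The round world ("kissing lenses")**: if `FiniteSaturation` fails, NO diagonal point `(s,s)`, `s > 0`,
is saturated, while the two one-sided regions of `Z` still reach the corner tangentially to the diagonal
(`corner_dichotomy_generic`). [cite: LottiRomani1983, §1 (p. 173)] -/
theorem round_world (h : ¬ FiniteSaturation) {s : ℝ} (hs0 : 0 < s) :
    1 + s < omegaRect ℂ s 1 s := by
  refine lt_of_le_of_ne (by simpa using corner_lower s s) fun heq => h ?_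
  have hm0 : 0 < min s (1 / 2) := lt_min hs0 (by norm_num)
  have hst := sat_star hs0.le hs0.le (div_nonneg hm0.le hs0.le)
    ((div_le_one hs0).2 (min_le_left _ _)) (by rw [max_self]; exact heq.symm)
  rw [div_mul_cancel₀ _ hs0.ne'] at hst
  exact finiteSaturation_iff_diag.2 ⟨min s (1 / 2), hm0, min_le_right _ _, hst⟩

/-- The saturated region is CONVEX in `(k,t)` (Lotti–Romani convexity; the light value `k + 1` is
linear): lens 1's dual-exponent profile `k ↦ sup {t : ω(1,k,t) = k+1}` is concave, its ladder `r(t)`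
convex. [cite: LottiRomani1983, §1 (p. 173)] -/
theorem sat_region_convex {k₁ t₁ k₂ t₂ μ : ℝ} (hk₁ : 0 ≤ k₁) (ht₁ : 0 ≤ t₁) (hk₂ : 0 ≤ k₂)
    (ht₂ : 0 ≤ t₂) (hμ0 : 0 ≤ μ) (hμ1 : μ ≤ 1) (h₁ : omegaRect ℂ 1 k₁ t₁ = k₁ + 1)
    (h₂ : omegaRect ℂ 1 k₂ t₂ = k₂ + 1) :
    omegaRect ℂ 1 (μ * k₁ + (1 - μ) * k₂) (μ * t₁ + (1 - μ) * t₂) = μ * k₁ + (1 - μ) * k₂ + 1 := by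
  have h := LottiRomani1983_convexComb_le ℂ (x := 1) (y := k₁) (z := t₁) (x' := 1) (y' := k₂)
    (z' := t₂) (a := μ) (b := 1 - μ) zero_le_one hk₁ ht₁ zero_le_one hk₂ ht₂ hμ0 (sub_nonneg.2 hμ1)
  have h1 : μ * 1 + (1 - μ) * 1 = 1 := by ring
  rw [h1, h₁, h₂] at h
  refine le_antisymm (by linarith) ?_
  linarith [add_le_omegaRect₁₂ ℂ 1 (μ * k₁ + (1 - μ) * k₂) (μ * t₁ + (1 - μ) * t₂)]

end Summit.MatrixMultiplication.MatrixMultiplication.Theorems.FarEdgeDescentCornerZeroSet
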